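import Literature.AlgebraicTopology.SingularHomology.LerayHirschPair
import Literature.AlgebraicTopology.SingularHomology.CohomologyDisjointOpenCover
import HarnessLib

/-!
# Leray–Hirsch: the union step and the disjoint-union step

D. Husemoller, *Fibre Bundles* (3rd ed. 1994), Ch. 17 §1, proof of Thm. 1.1: with
`θ_U : K(U) = ⊕ⱼ H*⁻ᵈʲ(U) → L(U) = H*(p⁻¹U)`, "if `θ_U`, `θ_V`, `θ_{U∩V}` are isomorphisms then so
is `θ_{U∪V}`" (Mayer–Vietoris and the five lemma) and `θ` is compatible with disjoint unions
(`K`, `L` are additive). A. Hatcher, *Algebraic Topology* (2002), proof of Thm. 4D.1 p. 433 (the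
same two steps). For a map `p : E → B`, classes `cⱼ ∈ Hᵈʲ(E; R)` and `U ⊆ B` write
`IsLH U` for: `θ : Π_{d j ≤ k} Hᵏ⁻ᵈʲ(U) → Hᵏ(p⁻¹U)`, `a ↦ Σ p^*aⱼ ⌣ cⱼ|`, is bijective for all `k`.

* `LerayHirsch.isLH_union`: `U`, `V` open, `IsLH U`, `IsLH V`, `IsLH (U ∩ V)` ⇒ `IsLH (U ∪ V)`.
  Proof: the pair step of `LerayHirschPair` twice — `θ` for `p⁻¹V → V` and for `p⁻¹(U∩V) → U∩V`
  give the relative `θ` of `(p⁻¹V, p⁻¹(U∩V))`; EXCISION (`RelativeCochainsExcision`, on total space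
  and base, compatible with `θ` by `map_lhRel`) turns it into the relative `θ` of
  `(p⁻¹(U∪V), p⁻¹U)`; with `θ` for `p⁻¹U → U` the pair step gives `θ` for `p⁻¹(U∪V) → U∪V`.
* `LerayHirsch.isLH_iUnion_of_pairwise_disjoint`: for pairwise disjoint open `Uᵢ` with `IsLH Uᵢ`,
  `IsLH (⋃ Uᵢ)` (cohomology of a disjoint open union is the product, `CohomologyDisjointOpenCover`,
  on both sides, and `θ` commutes with restrictions).
* transport of `IsLH`-type statements along homeomorphisms / cohomology isomorphisms commuting
  with the projections (`bijective_iff_of_square`, `isLH_iff_piece`, …), used to move between a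
  subset `S ⊆ B` and its copies inside subspaces.

Everything is proved; no named facts.

## References

* D. Husemoller, *Fibre Bundles*, GTM 20, Springer 1994, Ch. 17 §1 Thm. 1.1 (proof). [HusemollerFibreBundles1994]
* A. Hatcher, *Algebraic Topology*, CUP 2002, §4.D Thm. 4D.1 (proof), §3.1 p. 201 (excision), p. 202. [HatcherAT2002]
-/

noncomputable section

open CategoryTheory Function Set

universe u w

namespace Literature.AlgebraicTopology.SingularHomology

/-! ### Copies of a subset inside subspaces -/

section Incl

variable {Y : Type u} [TopologicalSpace Y]

/-- `↥S ≃ₜ` the copy `val⁻¹ S` of `S ⊆ W` inside the subspace `↥W`. [folklore] -/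
def inclHomeomorph {W S : Set Y} (h : S ⊆ W) : ↥S ≃ₜ ↥(Subtype.val ⁻¹' S : Set ↥W) where
  toFun x := ⟨⟨x.1, h x.2⟩, x.2⟩
  invFun y := ⟨y.1.1, y.2⟩
  left_inv _ := rfl
  right_inv _ := rfl
  continuous_toFun := (continuous_subtype_val.subtype_mk _).subtype_mk _
  continuous_invFun := (continuous_subtype_val.comp continuous_subtype_val).subtype_mk _

/-- `↥(S₁ ∩ W₂) ≃ₜ` the copy of `S₁` inside the copy of `W₂ ⊆ W` inside `↥W`. [folklore] -/
def inclHomeomorph₂ {W W₂ S₁ : Set Y} (h : W₂ ⊆ W) :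
    ↥(S₁ ∩ W₂) ≃ₜ ↥(Subtype.val ⁻¹' (Subtype.val ⁻¹' S₁ : Set ↥W) : Set ↥(Subtype.val ⁻¹' W₂ : Set ↥W)) where
  toFun x := ⟨⟨⟨x.1, h x.2.2⟩, x.2.2⟩, x.2.1⟩
  invFun y := ⟨y.1.1.1, y.2, y.1.2⟩
  left_inv _ := rfl
  right_inv _ := rfl
  continuous_toFun := ((continuous_subtype_val.subtype_mk _).subtype_mk _).subtype_mk _
  continuous_invFun :=
    ((continuous_subtype_val.comp continuous_subtype_val).comp continuous_subtype_val).subtype_mk _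

end Incl

namespace LerayHirsch

variable (R : Type u) [CommRing R] {ι : Type w} [Fintype ι] (d : ι → ℕ)

/-! ### Transport -/

section Transport

variable {X₁ B₁ X₂ B₂ : Type u} [TopologicalSpace X₁] [TopologicalSpace B₁] [TopologicalSpace X₂] [TopologicalSpace B₂]

/-- **Transport** of "`θ` bijective in all degrees" along a commuting square `q₁ ∘ f = g ∘ q₂` whose
horizontal maps induce cohomology isomorphisms and match the classes (`f^* c₁ⱼ = c₂ⱼ`).
[cite: HusemollerFibreBundles1994, Ch. 17 §1 Thm. 1.1 (proof)] -/
theorem bijective_iff_of_square (q₁ : C(X₁, B₁)) (q₂ : C(X₂, B₂)) (f : C(X₂, X₁)) (g : C(B₂, B₁))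
    (hfg : q₁.comp f = g.comp q₂) (c₁ : (j : ι) → singularCohomology R R X₁ (d j))
    (c₂ : (j : ι) → singularCohomology R R X₂ (d j)) (hc : ∀ j, singularCohomology.map R R f (d j) (c₁ j) = c₂ j)
    (hf : ∀ n, Bijective (singularCohomology.map R R f n)) (hg : ∀ n, Bijective (singularCohomology.map R R g n)) :
    (∀ k, Bijective (lhMap R d q₁ c₁ k)) ↔ ∀ k, Bijective (lhMap R d q₂ c₂ k) := by
  have : c₂ = fun j ↦ singularCohomology.map R R f (d j) (c₁ j) := funext fun j ↦ (hc j).symm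
  subst this
  exact forall_congr' fun k ↦ bijective_lhMap_iff R d q₁ q₂ f g hfg c₁ hf hg k

/-- Transport along homeomorphisms commuting with the projections and matching the classes.
[cite: HusemollerFibreBundles1994, Ch. 17 §1 Thm. 1.1 (proof)] -/
theorem bijective_iff_of_homeomorph (q₁ : C(X₁, B₁)) (q₂ : C(X₂, B₂)) (φ : X₂ ≃ₜ X₁) (ψ : B₂ ≃ₜ B₁)
    (hfg : q₁.comp (φ : C(X₂, X₁)) = (ψ : C(B₂, B₁)).comp q₂) (c₁ : (j : ι) → singularCohomology R R X₁ (d j))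
    (c₂ : (j : ι) → singularCohomology R R X₂ (d j))
    (hc : ∀ j, singularCohomology.map R R (φ : C(X₂, X₁)) (d j) (c₁ j) = c₂ j) :
    (∀ k, Bijective (lhMap R d q₁ c₁ k)) ↔ ∀ k, Bijective (lhMap R d q₂ c₂ k) :=
  bijective_iff_of_square R d q₁ q₂ φ ψ hfg c₁ c₂ hc
    (fun n ↦ (singularCohomology.mapIso R R φ n).toLinearEquiv.bijective)
    (fun n ↦ (singularCohomology.mapIso R R ψ n).toLinearEquiv.bijective)

end Transport

/-! ### `IsLH` for subsets of the base -/

variable {X B : Type u} [TopologicalSpace X] [TopologicalSpace B]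
  (p : C(X, B)) (c : (j : ι) → singularCohomology R R X (d j))

/-- **`IsLH U`**: the Leray–Hirsch comparison map of `p⁻¹U → U` (with the restricted classes),
`(aⱼ) ↦ Σⱼ p^*aⱼ ⌣ cⱼ|p⁻¹U : Π_{d j ≤ k} Hᵏ⁻ᵈʲ(U) → Hᵏ(p⁻¹U)`, is bijective in every degree
(Husemoller: "`θ_U` is an isomorphism"). [cite: HusemollerFibreBundles1994, Ch. 17 §1 Thm. 1.1 (proof)] -/
def IsLH (U : Set B) : Prop := ∀ k, Bijective (lhMap R d (resMap p U) (resCls p U c) k)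

/-- `IsLH` only depends on the set. [folklore] -/
theorem isLH_congr {U U' : Set B} (h : U = U') : IsLH R d p c U ↔ IsLH R d p c U' := by subst h; exact Iff.rfl

/-- **`IsLH S` read inside `p⁻¹T → T`** (`S ⊆ T`): it is the bijectivity of `θ` for the copy
`q⁻¹(val⁻¹S) → val⁻¹S` of `p⁻¹S → S`, `q = p| : p⁻¹T → T`. [folklore] -/
theorem isLH_iff_piece {T S : Set B} (h : S ⊆ T) :
    IsLH R d p c S ↔ ∀ k, Bijective (lhMap R d (resMap (resMap p T) (Subtype.val ⁻¹' S))
      (resCls (resMap p T) (Subtype.val ⁻¹' S) (resCls p T c)) k) := by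
  refine (bijective_iff_of_homeomorph R d (resMap (resMap p T) (Subtype.val ⁻¹' S)) (resMap p S)
    (inclHomeomorph (W := p ⁻¹' T) (S := p ⁻¹' S) (preimage_mono h)) (inclHomeomorph h) rfl _ _ fun j ↦ ?_).symm
  rw [← ModuleCat.comp_apply, ← singularCohomology.map_comp, ← ModuleCat.comp_apply, ← singularCohomology.map_comp]
  rfl

/-- **`IsLH (S₁ ∩ W₂)` read two levels down** inside `p⁻¹T → T` (`W₂ ⊆ T`): bijectivity of `θ` for
the copy of `p⁻¹(S₁ ∩ W₂) → S₁ ∩ W₂` inside the copy of `p⁻¹W₂ → W₂` inside `p⁻¹T → T`. [folklore] -/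
theorem isLH_iff_piece₂ {T W₂ S₁ : Set B} (h : W₂ ⊆ T) :
    IsLH R d p c (S₁ ∩ W₂) ↔ ∀ k, Bijective (lhMap R d
      (resMap (resMap (resMap p T) (Subtype.val ⁻¹' W₂)) (Subtype.val ⁻¹' (Subtype.val ⁻¹' S₁)))
      (resCls (resMap (resMap p T) (Subtype.val ⁻¹' W₂)) (Subtype.val ⁻¹' (Subtype.val ⁻¹' S₁))
        (resCls (resMap p T) (Subtype.val ⁻¹' W₂) (resCls p T c))) k) := by
  refine (bijective_iff_of_homeomorph R d
    (resMap (resMap (resMap p T) (Subtype.val ⁻¹' W₂)) (Subtype.val ⁻¹' (Subtype.val ⁻¹' S₁))) (resMap p (S₁ ∩ W₂))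
    (inclHomeomorph₂ (W := p ⁻¹' T) (W₂ := p ⁻¹' W₂) (S₁ := p ⁻¹' S₁) (preimage_mono h)) (inclHomeomorph₂ h) rfl _ _
    fun j ↦ ?_).symm
  rw [← ModuleCat.comp_apply, ← singularCohomology.map_comp, ← ModuleCat.comp_apply, ← singularCohomology.map_comp,
    ← ModuleCat.comp_apply, ← singularCohomology.map_comp]
  rfl

/-! ### The union step -/

/-- **The union step of Leray–Hirsch** (Husemoller 17 §1 Thm. 1.1, proof; Hatcher Thm. 4D.1, proof):
for `U`, `V` open in `B`, if `θ` is bijective over `U`, over `V` and over `U ∩ V` then it is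
bijective over `U ∪ V`. [cite: HusemollerFibreBundles1994, Ch. 17 §1 Thm. 1.1 (proof)] [cite: HatcherAT2002, §4.D Thm. 4D.1 (proof)] -/
theorem isLH_union {U V : Set B} (hU : IsOpen U) (hV : IsOpen V) (h₁ : IsLH R d p c U) (h₂ : IsLH R d p c V)
    (h₁₂ : IsLH R d p c (U ∩ V)) : IsLH R d p c (U ∪ V) := by
  -- notation: everything inside `q : p⁻¹T → T`, `T = U ∪ V`
  let T : Set B := U ∪ V
  let q : C(↥(p ⁻¹' T), ↥T) := resMap p T
  let cT : (j : ι) → singularCohomology R R ↥(p ⁻¹' T) (d j) := resCls p T c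
  let AB : Set ↥T := Subtype.val ⁻¹' U
  let A₂B : Set ↥T := Subtype.val ⁻¹' V
  let q₂ : C(↥(q ⁻¹' A₂B), ↥A₂B) := resMap q A₂B
  let c₂ : (j : ι) → singularCohomology R R ↥(q ⁻¹' A₂B) (d j) := resCls q A₂B cT
  let A'' : Set ↥A₂B := Subtype.val ⁻¹' AB
  -- (1) `θ` over the copies of `U`, `V`, `U ∩ V`
  have hA : ∀ k, Bijective (lhMap R d (resMap q AB) (resCls q AB cT) k) :=
    (isLH_iff_piece R d p c (T := T) subset_union_left).1 h₁
  have hV' : ∀ k, Bijective (lhMap R d q₂ c₂ k) := (isLH_iff_piece R d p c (T := T) subset_union_right).1 h₂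
  have hUV' : ∀ k, Bijective (lhMap R d (resMap q₂ A'') (resCls q₂ A'' c₂) k) :=
    (isLH_iff_piece₂ R d p c (T := T) (W₂ := V) (S₁ := U) subset_union_right).1 h₁₂
  -- (2) the relative `θ` of the small pair `(q⁻¹A₂B, ·)` over `(A₂B, A'')`
  have hRel₂ : ∀ k, Bijective (lhRel R d q₂ A'' c₂ k) := bijective_lhRel_of_abs R d q₂ A'' c₂ hV' hUV'
  -- (3) excision: the relative `θ` of `(p⁻¹T, q⁻¹AB)` over `(T, AB)`
  have hoAB : IsOpen AB := hU.preimage continuous_subtype_val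
  have hoA₂B : IsOpen A₂B := hV.preimage continuous_subtype_val
  have hoX : IsOpen (q ⁻¹' AB) := hoAB.preimage q.continuous
  have hoX₂ : IsOpen (q ⁻¹' A₂B) := hoA₂B.preimage q.continuous
  have hcovX : interior (q ⁻¹' AB) ∪ interior (q ⁻¹' A₂B) = univ := by
    rw [hoX.interior_eq, hoX₂.interior_eq]
    exact eq_univ_of_forall fun x ↦ x.2
  have hcovB : interior AB ∪ interior A₂B = univ := by
    rw [hoAB.interior_eq, hoA₂B.interior_eq]
    exact eq_univ_of_forall fun b ↦ b.2
  have hRel : ∀ k, Bijective (lhRel R d q AB cT k) := fun k ↦ by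
    have hnat := map_lhRel R d q q₂ (subsetIncl (q ⁻¹' A₂B)) (subsetIncl A₂B) (comp_subsetIncl_preimage q A₂B)
      (A := AB) (A'' := A'') (mapsTo_preimage Subtype.val AB) cT k
    have hexcX : Bijective (relSingularCohomology.map R R (subsetIncl (q ⁻¹' A₂B))
        (mapsTo_of_comm q q₂ (subsetIncl (q ⁻¹' A₂B)) (subsetIncl A₂B) (comp_subsetIncl_preimage q A₂B)
          (mapsTo_preimage Subtype.val AB)) k) := by
      have := relSingularCohomology.isIso_map_subsetIncl_of_interior R R (q ⁻¹' AB) (q ⁻¹' A₂B) hcovX k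
      exact ConcreteCategory.bijective_of_isIso
        (relSingularCohomology.map R R (subsetIncl (q ⁻¹' A₂B)) (mapsTo_preimage Subtype.val (q ⁻¹' AB)) k)
    have hexcB : Bijective (srcRelMap R d (subsetIncl A₂B) (mapsTo_preimage Subtype.val AB) k) :=
      srcRelMap_bijective R d (subsetIncl A₂B) (mapsTo_preimage Subtype.val AB) (fun n ↦ by
        have := relSingularCohomology.isIso_map_subsetIncl_of_interior R R AB A₂B hcovB n
        exact ConcreteCategory.bijective_of_isIso
          (relSingularCohomology.map R R (subsetIncl A₂B) (mapsTo_preimage Subtype.val AB) n)) k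
    have hcomp : (relSingularCohomology.map R R (subsetIncl (q ⁻¹' A₂B))
        (mapsTo_of_comm q q₂ (subsetIncl (q ⁻¹' A₂B)) (subsetIncl A₂B) (comp_subsetIncl_preimage q A₂B)
          (mapsTo_preimage Subtype.val AB)) k) ∘ (lhRel R d q AB cT k) =
        (lhRel R d q₂ A'' c₂ k) ∘ (srcRelMap R d (subsetIncl A₂B) (mapsTo_preimage Subtype.val AB) k) :=
      funext hnat
    have h2 : Bijective ((lhRel R d q₂ A'' c₂ k) ∘ (srcRelMap R d (subsetIncl A₂B) (mapsTo_preimage Subtype.val AB) k)) :=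
      (hRel₂ k).comp hexcB
    rw [← hcomp] at h2
    exact (Function.Bijective.of_comp_iff' hexcX _).1 h2
  -- (4) the pair step
  exact bijective_lhMap_of_rel R d q AB cT hRel hA

/-! ### The disjoint-union step -/

/-- **The disjoint-union step of Leray–Hirsch**: for pairwise disjoint open `Uᵢ ⊆ B` with `θ`
bijective over each `Uᵢ`, `θ` is bijective over `⋃ Uᵢ` (both `K` and `L` turn disjoint unions
into products). [cite: HusemollerFibreBundles1994, Ch. 17 §1 Thm. 1.1 (proof)] [cite: HatcherAT2002, §3.1 p. 202] -/
theorem isLH_iUnion_of_pairwise_disjoint {J : Type*} {U : J → Set B} (hUo : ∀ i, IsOpen (U i))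
    (hdisj : Pairwise (Disjoint on U)) (h : ∀ i, IsLH R d p c (U i)) : IsLH R d p c (⋃ i, U i) := by
  intro k
  let T : Set B := ⋃ i, U i
  let q : C(↥(p ⁻¹' T), ↥T) := resMap p T
  let cT : (j : ι) → singularCohomology R R ↥(p ⁻¹' T) (d j) := resCls p T c
  let AB : J → Set ↥T := fun i ↦ Subtype.val ⁻¹' U i
  let AX : J → Set ↥(p ⁻¹' T) := fun i ↦ q ⁻¹' AB i
  have hAB : IsClopenPartition AB :=
    IsClopenPartition.of_pairwise_disjoint (fun i ↦ (hUo i).preimage continuous_subtype_val)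
      (fun i j hij ↦ (hdisj hij).preimage _) (eq_univ_of_forall fun b ↦ mem_iUnion.2 ((mem_iUnion.1 b.2).imp fun _ hi ↦ hi))
  have hAX : IsClopenPartition AX :=
    IsClopenPartition.of_pairwise_disjoint (fun i ↦ ((hUo i).preimage continuous_subtype_val).preimage q.continuous)
      (fun i j hij ↦ ((hdisj hij).preimage _).preimage _) (eq_univ_of_forall fun x ↦ mem_iUnion.2 ((mem_iUnion.1 x.2).imp fun _ hi ↦ hi))
  have hpiece : ∀ i k, Bijective (lhMap R d (resMap q (AB i)) (resCls q (AB i) cT) k) := fun i ↦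
    (isLH_iff_piece R d p c (T := T) (subset_iUnion U i)).1 (h i)
  -- `θ` commutes with the restrictions to the pieces
  have hsq : (Pi.map fun i ↦ lhMap R d (resMap q (AB i)) (resCls q (AB i) cT) k) ∘
      (fun (a : Src R d ↥T k) (i : J) ↦ resSrc R d (AB i) k a) =
        (singularCohomology.piRestrict R R AX k) ∘ (lhMap R d q cT k) := by
    funext a i
    exact lhMap_resSrc R d q (AB i) cT k a
  -- the source side is a product too
  have h1 : Bijective (fun (a : Src R d ↥T k) (i : J) ↦ resSrc R d (AB i) k a) := by
    constructor
    · intro a a' haa'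
      funext j
      apply (singularCohomology.piRestrict_bijective (R := R) (M := R) hAB (k - d j.1)).1
      funext i
      exact congrFun (congrFun haa' i) j
    · intro b
      have hex : ∀ j : Idx d k, ∃ x, singularCohomology.piRestrict R R AB (k - d j.1) x = fun i ↦ b i j := fun j ↦
        (singularCohomology.piRestrict_bijective (R := R) (M := R) hAB _).2 _
      choose x hx using hex
      refine ⟨x, funext fun i ↦ funext fun j ↦ ?_⟩
      exact congrFun (hx j) i
  have h2 : Bijective ((Pi.map fun i ↦ lhMap R d (resMap q (AB i)) (resCls q (AB i) cT) k) ∘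
      (fun (a : Src R d ↥T k) (i : J) ↦ resSrc R d (AB i) k a)) :=
    (Function.Bijective.piMap fun i ↦ hpiece i k).comp h1
  rw [hsq] at h2
  exact (Function.Bijective.of_comp_iff' (singularCohomology.piRestrict_bijective (R := R) (M := R) hAX k) _).1 h2

/-- `IsLH ∅` (both sides vanish… rather: both sides are cohomology of empty spaces, and `θ` is the
zero map between zero modules) — obtained as the disjoint union over an empty family. [folklore] -/
theorem isLH_empty : IsLH R d p c ∅ := by
  have := isLH_iUnion_of_pairwise_disjoint R d p c (J := PEmpty.{1}) (U := fun _ ↦ ∅) (fun _ ↦ isOpen_empty)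
    (fun i ↦ i.elim) (fun i ↦ i.elim)
  rwa [isLH_congr R d p c (iUnion_of_empty _)] at this

end LerayHirsch

end Literature.AlgebraicTopology.SingularHomology
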